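import Summits.ABC.ABC.Theses.TwistAmplification

/-!
# Sketch (crux-ideate, ideator 1, round 1) — crux `ModerateWindowCount` (stmt-ABC-1973)

First lemmas / transfer targets for the two idea cards
`weber-point-vojta-transfer` and `packet-division-descent`.
Everything here is a `def … : Prop` (statements only; nothing is proved, nothing is sorried).

Dictionary.  A reduced global minimal model `W₀/ℤ` with `c₄ c₆ ≠ 0` has
`c₄³ − c₆² = 1728 Δ` (`WeierstrassCurve.c_relation`).  Write `Δ = k · w⁶` with `k`
sixth-power-free (`w := ∏ p^⌊v_p Δ/6⌋`).  Then `P_E := (c₄/w², c₆/w³)` is a rational point of the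
Mordell curve `M_k : y² = x³ − 1728 k` (the sextic twist by `k` of the CM curve
`A : y² = x³ − 1728 = X_comm`, uniformised by Weber's `γ₂ = j^{1/3}`, `γ₃ = (j − 1728)^{1/2}`).
For SEMISTABLE `W₀`: `N = rad Δ = rad(k)·rad(w)/rad(gcd(k,w))`, `x(P_E) = c₄/w²` is in lowest
terms, `max(|c₄|³,|Δ|) = max(|num x|³, |k|·(den x)³)`, and
`|Δ|·rad k ≤ (N · pow(w) · rad(gcd(k,w)))⁶`, `pow(w) := w/rad(w)` (tangency mass).
-/

set_option linter.dupNamespace false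

namespace Summit.ABC.ABC.Cruxes.ModerateWindowCount.WeberMordellSketch

open IsDedekindDomain WeierstrassCurve
open Summit.ABC.ABC.Theses.TwistAmplification

noncomputable section

/-- radical of an integer: product of its prime divisors (Mathlib `UniqueFactorizationMonoid.radical` on `ℕ`). -/
def rad (n : ℤ) : ℕ := UniqueFactorizationMonoid.radical n.natAbs

/-- powerful excess ("tangency mass, exponentiated"): `pow n = |n| / rad n`. -/
def powPart (n : ℤ) : ℕ := n.natAbs / rad n

/-- `k` is sixth-power-free. -/
def SixthPowerFree (k : ℤ) : Prop := ∀ p : ℕ, p.Prime → ¬ ((p : ℤ) ^ 6 ∣ k)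

/-- the sextic-twist (Mordell) family of the CM curve `A : y² = x³ − 1728` (`j = 0`). -/
def mordell (k : ℤ) : WeierstrassCurve ℚ := ⟨0, 0, 0, 0, -1728 * (k : ℚ)⟩

/-- The reduced-global-minimal-model predicate of the route's window sets (without the window). -/
def IsCore (W₀ : WeierstrassCurve ℤ) : Prop :=
  (W₀.baseChange ℚ).IsElliptic ∧ (∀ v : HeightOneSpectrum ℤ, (W₀.baseChange ℚ).IsMinimalAt v) ∧
    (W₀.a₁ = 0 ∨ W₀.a₁ = 1) ∧ (W₀.a₃ = 0 ∨ W₀.a₃ = 1) ∧ (W₀.a₂ = -1 ∨ W₀.a₂ = 0 ∨ W₀.a₂ = 1) ∧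
      W₀.c₄ ≠ 0 ∧ W₀.c₆ ≠ 0

/-- conductor as a real number -/
def condR (W₀ : WeierstrassCurve ℤ) : ℝ := (((W₀.baseChange ℚ).conductorNorm ℤ : ℕ) : ℝ)

/-- generalized Szpiro size `M⁺ = max(|Δ|, |c₄|³)` as a real number -/
def mPlus (W₀ : WeierstrassCurve ℤ) : ℝ := ((max |W₀.Δ| (|W₀.c₄| ^ 3) : ℤ) : ℝ)

/-- `Fin κ`: only finitely many cores have generalized Szpiro size `M⁺ ≥ N^κ`.
(κ-SQUEEZE: the crux at level `σ` follows from `Fin κ` for ONE `κ ∈ (6, σ)`.) -/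
def CoreFiniteness (κ : ℝ) : Prop :=
  Set.Finite {W₀ : WeierstrassCurve ℤ | IsCore W₀ ∧ condR W₀ ^ κ ≤ mPlus W₀}

/-- SUPPORT (provable now, elementary): the κ-squeeze. Given `σ > 6` choose `κ := (6+σ)/2`;
the window set at `(κ,σ,X)` is contained in the finite set of `CoreFiniteness κ`, so
`T ≤ C := ncard` with `δ := 0 < (σ−κ)/(2σ−6)`. -/
def SqueezeGlue : Prop := (∀ κ : ℝ, 6 < κ → CoreFiniteness κ) → ModerateWindowCount

/-- Semistable generalized Szpiro (`M⁺ ≤ C·N^{6+τ}` on semistable minimal models). -/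
def SemistableGenSzpiro : Prop :=
  ∀ τ : ℝ, 0 < τ → ∃ C : ℝ, ∀ W₀ : WeierstrassCurve ℤ, IsCore W₀ →
    (W₀.baseChange ℚ).IsSemistable ℤ → mPlus W₀ ≤ C * condR W₀ ^ (6 + τ)

/-- FIRST LEMMA of card `weber-point-vojta-transfer` (the dictionary inequality; elementary,
provable now from `N = rad Δ` for semistable minimal models, `|k| ≤ rad(k)⁵` for sixth-power-free
`k`, and multiplicativity of `rad`):  `|Δ| · rad k ≤ (N · pow(w) · rad(gcd(k,w)))⁶`. -/
def DictionaryInequality : Prop :=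
  ∀ (W₀ : WeierstrassCurve ℤ) (k w : ℤ), IsCore W₀ → (W₀.baseChange ℚ).IsSemistable ℤ →
    SixthPowerFree k → w ≠ 0 → W₀.Δ = k * w ^ 6 →
      ((W₀.Δ.natAbs * rad k : ℕ) : ℝ) ≤ (condR W₀ * powPart w * rad (Int.gcd k w)) ^ (6 : ℕ)

/-- TRANSFER TARGET C⁺ (Δ-face; "arithmetic Ulmer–Urzúa" / tangency-mass bound on the sextic-twist
family `M_k : y² = x³ − 1728k`, uniformly in the sixth-power-free twist parameter `k`):
for a rational point `(x,y)` the denominator of `x` is `w²`, `pow(w)⁶ = den(x)³ / rad(den x)⁶`, and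
the bound reads  `den(x)³ · rad(gcd(k,den x))⁶ ≤ C · rad k · rad(den x)⁶ · (rad k · rad(den x))^τ`. -/
def TangencyMassBound : Prop :=
  ∀ τ : ℝ, 0 < τ → ∃ C : ℝ, ∀ (k : ℤ) (x y : ℚ), SixthPowerFree k → k ≠ 0 →
    y ^ 2 = x ^ 3 - 1728 * (k : ℚ) →
      ((x.den : ℝ) ^ 3) * ((rad (Int.gcd k x.den) : ℝ) ^ 6) ≤
        C * (rad k : ℝ) * ((rad (x.den : ℤ) : ℝ) ^ 6) * (((rad k : ℝ) * (rad (x.den : ℤ) : ℝ)) ^ τ)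

/-- TRANSFER TARGET C⁺ (both faces; = truncation-one Vojta for `(A, O)`, `A : y² = x³ − 1728`, at
the degree-6 Weber points, written in `M_k`-coordinates): `max(|num x|³, |k|·den(x)³)` is the
generalized Szpiro size `M⁺` of the core and `rad k · rad(den x)/rad(gcd)` is its conductor. -/
def WeberVojtaBound : Prop :=
  ∀ τ : ℝ, 0 < τ → ∃ C : ℝ, ∀ (k : ℤ) (x y : ℚ), SixthPowerFree k → k ≠ 0 →
    y ^ 2 = x ^ 3 - 1728 * (k : ℚ) →
      max ((|x.num| : ℝ) ^ 3) ((|k| : ℝ) * (x.den : ℝ) ^ 3) ≤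
        C * (((rad k : ℝ) * (rad (x.den : ℤ) : ℝ)) / (rad (Int.gcd k x.den) : ℝ)) ^ (6 + τ)

/-- SUPPORT (provable now modulo tree facts): the transfer.  For a semistable core write
`Δ = k w⁶`, put `x := c₄/w²`, `y := c₆/w³` (`c_relation`), note `den x = w²` (semistable ⇒
`p ∣ w ⇒ p ∤ c₄`) and `N = rad Δ = rad k · rad w / rad(gcd)`. -/
def TransferGlue : Prop := WeberVojtaBound → SemistableGenSzpiro

/-- SUPPORT (tree chain, Bombieri–Gubler 12.5.12 pattern: semistable generalized Szpiro ⇒ abc on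
Frey curves with `16 ∣ abc` ⇒ abc ⇒ `GeneralizedSzpiroConjectureBG` ⇒ finiteness of cores above
every `κ > 6`). -/
def SzpiroChain : Prop := SemistableGenSzpiro → ∀ κ : ℝ, 6 < κ → CoreFiniteness κ

/-- FIRST LEMMA of card `packet-division-descent` (formal-group level law, Silverman AEC IV.6.4 /
VII.3; arXiv:math/0404412 Thm 1): on `M_k`, if `Q = (x,y)` has `p ∣ den x` and `m ≥ 1`, then
`v_p(den x([m]Q)) = v_p(den x(Q)) + 2 v_p(m)` (`den x = w²`).  Stated for the affine point type of
Mathlib; `p ≥ 5`, `p ∤ 6k` (good reduction, formal group of height one or two). -/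
def FormalGroupLevelLaw : Prop :=
  ∀ (k : ℤ) (p : ℕ) (m : ℕ), p.Prime → 5 ≤ p → ¬ ((p : ℤ) ∣ 6 * k) → 1 ≤ m →
    ∀ (x y : ℚ) (h : (mordell k).toAffine.Nonsingular x y),
      (p : ℤ) ∣ (x.den : ℤ) →
        ∀ x' y' : ℚ, (∃ h' : (mordell k).toAffine.Nonsingular x' y',
            (Affine.Point.some x' y' h' : (mordell k).toAffine.Point) = m • (Affine.Point.some x y h : (mordell k).toAffine.Point)) →
          padicValNat p x'.den = padicValNat p x.den + 2 * padicValNat p m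

/-- DESCENT INEQUALITY (card `packet-division-descent`, provable from `FormalGroupLevelLaw`):
the Szpiro excess `X := log|Δ| − 6 log N` of the core attached to `[m]Q` exceeds that of the core
attached to `Q` by at most `6 log m + 6 log(pow · overlap of the NEW primes)`.  Typed in the
exponentiated form on denominators: `den(x([m]Q))` divides `m² · den(x(Q)) · (new part)`, where the
new part is coprime to `den(x(Q))` (new primes MAY divide `k`: they are then overlap primes `gcd(k,w)`;
the additive mass of intermediate cores cancels out of the excess budget, see the card). -/
def DivisionDescent : Prop :=
  ∀ (k : ℤ) (m : ℕ), 1 ≤ m → SixthPowerFree k → k ≠ 0 →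
    ∀ (x y : ℚ) (h : (mordell k).toAffine.Nonsingular x y)
      (x' y' : ℚ) (h' : (mordell k).toAffine.Nonsingular x' y'),
      (Affine.Point.some x' y' h' : (mordell k).toAffine.Point) = m • (Affine.Point.some x y h : (mordell k).toAffine.Point) →
        ∃ newPart : ℕ, Nat.Coprime newPart x.den ∧
          x'.den ∣ m ^ 2 * x.den * newPart ∧ x.den ∣ x'.den

end

end Summit.ABC.ABC.Cruxes.ModerateWindowCount.WeberMordellSketch
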